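import Summits.QuantumFields.YangMills.Theorems.UnitScaleTiltProp7LatticeBoxPoincareL2
import Mathlib.Analysis.InnerProductSpace.PiL2
import HarnessLib

/-!
# Route `UnitScaleTilt`, crux K1 «MinimiserStabilityRegPr» (stmt-QuantumFields-19200), route-R E′ (A′)-on-Σ, P-A2 (β), row `hMcomb₂` — located difficulty H2-1,
# THE DEVICE: THE d = 3 LOCALISED-MASS (HARDY-TYPE) ROW ON CONCENTRIC LATTICE BOXES

Cell `ym3-torus`, width seat `ym3-torus-px18` (gen 4).  THEOREMS ONLY (0 `def`, 0 `sorry`); `--supports stmt-QuantumFields-19200 --as helper`, «(O2) groundwork»,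
count-neutral.  YM₃ on T³ is a ladder rung (R3), not the Clay problem; nothing here claims `hMcomb₂`, `hMcomb`, (β), the stub, the crux, d = 4 or the gap.

THE POINT (★routeR-w1 g9 MASTER MEMO `DESIGN-N3COMB-LINEAR-CORE` §4, H2-1 DEVICE «cell mean + scale-telescoped oscillation (volume-free, d = 3)»).  The `ℓ¹`
propagation of the nonlinear remainders through the `Λ`-sector of the cornered comb propagator only SAMPLES the field near the level-`l` CORNERS; the supplier of
`hMcomb₂` therefore needs the mass of a lattice field INSIDE A SMALL BOX `Q_ρ(a)` bounded by the VOLUME FRACTION of the mass in a large concentric box `Q_R(a)` plus a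
gradient term whose coefficient is `(ρ+1)²` — the SMALL radius squared, independent of `R` («volume-free»).  In `d = 3` this is a Hardy-type inequality; on the
lattice it follows from the box Poincaré inequality ✓ `Prop7LatticeBoxPoincareL2.exc_le_gradSq` and the dyadic telescoping of box means ✓ `sq_boxAvg_sub_dyadic_le`,
whose geometric series `Σ 2^{−k∕2}` is exactly the `d = 3` transience (in `d = 2` the coefficient would carry `log(R∕ρ)`).

WHAT IS PROVED (ns `…Theorems.Prop7LatticeLocalisedMass`; letters lit `B4Eq19LatticeOperators`∕`B4Eq19LatticeBoxMeans`: `box`, `boxAvg`, `exc`, `gradSq`, `fdiff`).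
* §1 (any `d`) `exc_le_four_mul_gradSq` (`exc ≤ 4d(ρ+1)²·gradSq`), `exc_le_gradSq_of_subset` (the Morrey weight `A := 4d·gradSq v Q` serves every sub-box),
  `exists_dyadic_exponent` (`2^K(ρ+1) ≤ R+1 < 2^{K+1}(ρ+1)`).
* §2 (`d = 3`) ★ `sq_boxAvg_sub_le_gradSq_div` — MEAN DRIFT ACROSS CONCENTRIC BOXES: `(avg_ρ − avg_R)² ≤ 1632·gradSq v Q_R(a)∕(ρ+1)` (`0 ≤ ρ ≤ R`);
  `card_mul_sq_boxAvg_sub_le` (`#Q_ρ·(avg_ρ − avg_R)² ≤ 13056(ρ+1)²·gradSq`); `sum_sq_sub_boxAvg_le` (`Σ_{Q_ρ}(v − avg_R)² ≤ 13068(ρ+1)²·gradSq`).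
* §3 (`d = 3`) ★★ `sum_sq_le_localisedMass` — THE ROW: for every `t > 0`,
  `Σ_{x ∈ Q_ρ(a)} v x² ≤ (1+t)·(#Q_ρ(a)∕#Q_R(a))·Σ_{x ∈ Q_R(a)} v x² + (1+t⁻¹)·13068·(ρ+1)²·gradSq v Q_R(a)`;
  `sum_sq_le_localisedMass_two` (`t = 1`).
* §4 (`d = 3`) ★★ `sum_normSq_le_localisedMass` — the same row, SAME constants, for fields valued in a finite-dimensional real inner-product space `V`
  (coordinates in an orthonormal basis; every term is a sum of squares of coordinates), gradient energy written out as `Σ_{y ∈ Q_R} Σ_μ ‖Y(y + e_μ) − Y y‖²`.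
HONEST SCOPE.  Folklore real-variable lattice analysis; constants crude and ABSOLUTE (no `L`, no level, no member).  The sum over the level-`l` corners of ONE period cell
(disjoint concentric cells) is bookkeeping left to the consumer's letters.  References: M. Giaquinta, *Multiple integrals in the calculus of variations and nonlinear
elliptic systems*, Princeton 1983 [Giaquinta1984] (Ch. III §1 pp.64–72); T. Bałaban, CMP 96 (1984) 223–250 [Balaban1984PropagatorsII] ((1.9) p.226: the box Poincaré
inequality these rows iterate).
-/

set_option autoImplicit false

noncomputable section

open scoped BigOperators RealInnerProductSpace

namespace Summit.QuantumFields.YangMills.Theorems.Prop7LatticeLocalisedMass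

open Literature.MathematicalPhysics.QuantumFieldTheory.Balaban1983to89
open B4Eq19LatticeOperators B4Eq19LatticeBoxMeans B4Eq19LatticePoincareMorrey Finset
open Summit.QuantumFields.YangMills.Theorems.Prop7LatticeBoxPoincareL2

variable {d : ℕ}

/-! ## §1 The excess in the `(ρ+1)²` currency and the dyadic exponent (any `d`) -/

/-- `exc v z ρ ≤ 4d·(ρ+1)²·gradSq v Q_ρ(z)` — ✓ `exc_le_gradSq` with `(2ρ+1)² ≤ 4(ρ+1)²`. [folklore] [cite: Giaquinta1984, Ch. III §1 p.65] -/
theorem exc_le_four_mul_gradSq (v : Zd d → ℝ) (z : Zd d) {ρ : ℤ} (hρ : 0 ≤ ρ) :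
    exc v z ρ ≤ 4 * d * ((ρ : ℝ) + 1) ^ 2 * gradSq v (box z ρ) := by
  have h := exc_le_gradSq v z hρ
  have hρ' : (0 : ℝ) ≤ ρ := by exact_mod_cast hρ
  have h1 : ((2 * ρ + 1 : ℤ) : ℝ) ^ 2 ≤ 4 * ((ρ : ℝ) + 1) ^ 2 := by push_cast; nlinarith
  have hg := gradSq_nonneg v (box z ρ)
  have hd : (0 : ℝ) ≤ d := Nat.cast_nonneg d
  calc exc v z ρ ≤ d * ((2 * ρ + 1 : ℤ) : ℝ) ^ 2 * gradSq v (box z ρ) := h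
    _ ≤ d * (4 * ((ρ : ℝ) + 1) ^ 2) * gradSq v (box z ρ) :=
        mul_le_mul_of_nonneg_right (mul_le_mul_of_nonneg_left h1 hd) hg
    _ = 4 * d * ((ρ : ℝ) + 1) ^ 2 * gradSq v (box z ρ) := by ring

/-- the MORREY weight from the gradient energy: for `Q_r(a) ⊆ Q_R(z)`, `exc v a r ≤ (4d·gradSq v Q_R(z))·(r+1)²`. [folklore] [cite: Giaquinta1984, Ch. III §1 p.70] -/
theorem exc_le_gradSq_of_subset (v : Zd d → ℝ) {a z : Zd d} {r R : ℤ} (hr : 0 ≤ r) (hsub : box a r ⊆ box z R) :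
    exc v a r ≤ 4 * d * gradSq v (box z R) * ((r : ℝ) + 1) ^ 2 := by
  have h := exc_le_four_mul_gradSq v a hr
  have hm := gradSq_mono v hsub
  have hd : (0 : ℝ) ≤ 4 * d * ((r : ℝ) + 1) ^ 2 := by positivity
  calc exc v a r ≤ 4 * d * ((r : ℝ) + 1) ^ 2 * gradSq v (box a r) := h
    _ ≤ 4 * d * ((r : ℝ) + 1) ^ 2 * gradSq v (box z R) := mul_le_mul_of_nonneg_left hm hd
    _ = 4 * d * gradSq v (box z R) * ((r : ℝ) + 1) ^ 2 := by ring

/-- the DYADIC EXPONENT of a pair of radii: for `0 ≤ ρ ≤ R` there is `K` with `2^K(ρ+1) ≤ R+1 < 2^{K+1}(ρ+1)`. [folklore] -/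
theorem exists_dyadic_exponent {ρ R : ℤ} (hρ : 0 ≤ ρ) (hρR : ρ ≤ R) :
    ∃ K : ℕ, (2 : ℤ) ^ K * (ρ + 1) ≤ R + 1 ∧ R + 1 < (2 : ℤ) ^ (K + 1) * (ρ + 1) := by
  classical
  have hex : ∃ K : ℕ, R + 1 < (2 : ℤ) ^ (K + 1) * (ρ + 1) := by
    refine ⟨R.toNat, ?_⟩
    have h1 : (R.toNat : ℤ) + 2 ≤ (2 : ℤ) ^ (R.toNat + 1) := by
      have : ∀ n : ℕ, (n : ℤ) + 2 ≤ (2 : ℤ) ^ (n + 1) := by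
        intro n
        induction n with
        | zero => norm_num
        | succ n ih => rw [pow_succ]; push_cast; linarith
      exact this _
    have h2 : R ≤ (R.toNat : ℤ) := Int.self_le_toNat R
    have h3 : (1 : ℤ) ≤ ρ + 1 := by linarith
    have h4 : (0 : ℤ) < (2 : ℤ) ^ (R.toNat + 1) := by positivity
    nlinarith
  refine ⟨Nat.find hex, ?_, Nat.find_spec hex⟩
  rcases Nat.eq_zero_or_pos (Nat.find hex) with h0 | hpos
  · rw [h0]; simp; linarith
  · obtain ⟨K', hK'⟩ : ∃ K', Nat.find hex = K' + 1 := ⟨Nat.find hex - 1, by omega⟩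
    have hmin := Nat.find_min hex (m := K') (by omega)
    rw [hK']
    exact not_lt.mp hmin

/-! ## §2 The mean drift across concentric boxes (`d = 3`) -/

/-- ★ **MEAN DRIFT ACROSS CONCENTRIC BOXES** (`d = 3`): `(boxAvg v a ρ − boxAvg v a R)² ≤ 1632·gradSq v Q_R(a)∕(ρ+1)` for `0 ≤ ρ ≤ R` — the dyadic telescoping
✓ `sq_boxAvg_sub_dyadic_le` with the Morrey weight `A := 12·gradSq v Q_R(a)` (every dyadic excess obeys it by §1), plus one last non-dyadic step; the geometric series
is the `d = 3` transience. [folklore] [cite: Giaquinta1984, Ch. III §1 Lemma 1.1 p.70] -/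
theorem sq_boxAvg_sub_le_gradSq_div (hd : d = 3) (v : Zd d → ℝ) (a : Zd d) {ρ R : ℤ} (hρ : 0 ≤ ρ) (hρR : ρ ≤ R) :
    (boxAvg v a ρ - boxAvg v a R) ^ 2 ≤ 1632 * gradSq v (box a R) / ((ρ : ℝ) + 1) := by
  obtain ⟨K, hK1, hK2⟩ := exists_dyadic_exponent hρ hρR
  set G : ℝ := gradSq v (box a R) with hG
  have hG0 : 0 ≤ G := gradSq_nonneg v _
  have hρ0 : (0 : ℝ) ≤ ρ := by exact_mod_cast hρ
  have hρ1 : (0 : ℝ) < (ρ : ℝ) + 1 := by linarith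
  have hd3 : ((d : ℕ) : ℝ) = 3 := by rw [hd]; norm_num
  -- the dyadic radii `r_k + 1 = 2^k(ρ+1)`, `k ≤ K`, stay inside `Q_R(a)`
  have hpow_mono : ∀ k, k ≤ K → (2 : ℤ) ^ k * (ρ + 1) ≤ (2 : ℤ) ^ K * (ρ + 1) := by
    intro k hk
    exact mul_le_mul_of_nonneg_right (pow_le_pow_right₀ (by norm_num) hk) (by linarith)
  have hexc : ∀ k, k ≤ K → exc v a ((2 : ℤ) ^ k * (ρ + 1) - 1) ≤ (12 * G) * ((2 : ℝ) ^ k * ((ρ : ℝ) + 1)) ^ 2 := by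
    intro k hk
    have hrk0 : (0 : ℤ) ≤ (2 : ℤ) ^ k * (ρ + 1) - 1 := by
      have : (1 : ℤ) ≤ (2 : ℤ) ^ k := one_le_pow₀ (by norm_num)
      nlinarith
    have hle : (2 : ℤ) ^ k * (ρ + 1) - 1 ≤ R := by linarith [hpow_mono k hk]
    have h := exc_le_gradSq_of_subset v hrk0 (box_mono a hle)
    rw [hd3] at h
    have e : (((2 : ℤ) ^ k * (ρ + 1) - 1 : ℤ) : ℝ) + 1 = (2 : ℝ) ^ k * ((ρ : ℝ) + 1) := by push_cast; ring
    rw [e] at h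
    calc exc v a ((2 : ℤ) ^ k * (ρ + 1) - 1) ≤ 4 * 3 * G * ((2 : ℝ) ^ k * ((ρ : ℝ) + 1)) ^ 2 := h
      _ = (12 * G) * ((2 : ℝ) ^ k * ((ρ : ℝ) + 1)) ^ 2 := by ring
  -- dyadic part
  have hdy : (boxAvg v a ρ - boxAvg v a ((2 : ℤ) ^ K * (ρ + 1) - 1)) ^ 2 ≤ 64 * (12 * G) / ((ρ : ℝ) + 1) :=
    sq_boxAvg_sub_dyadic_le hd v a hρ (by positivity) K hexc
  -- last step `r_K → R`: `#Q_{r_K}·D ≤ exc_R ≤ 12G(R+1)² ≤ 48G(r_K+1)²`, `#Q_{r_K} ≥ (r_K+1)³`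
  set rK : ℤ := (2 : ℤ) ^ K * (ρ + 1) - 1 with hrK
  have hrK0 : (0 : ℤ) ≤ rK := by
    have : (1 : ℤ) ≤ (2 : ℤ) ^ K := one_le_pow₀ (by norm_num)
    rw [hrK]; nlinarith
  have hrKR : rK ≤ R := by rw [hrK]; linarith
  have hR0 : 0 ≤ R := hρ.trans hρR
  have erK : ((rK : ℤ) : ℝ) + 1 = (2 : ℝ) ^ K * ((ρ : ℝ) + 1) := by rw [hrK]; push_cast; ring
  have hrK1 : ((ρ : ℝ) + 1) ≤ (rK : ℝ) + 1 := by
    rw [erK]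
    have : (1 : ℝ) ≤ (2 : ℝ) ^ K := one_le_pow₀ (by norm_num)
    nlinarith
  have hrKpos : (0 : ℝ) < (rK : ℝ) + 1 := by linarith
  have hRlt : (R : ℝ) + 1 ≤ 2 * ((rK : ℝ) + 1) := by
    rw [erK]
    have : ((R + 1 : ℤ) : ℝ) < (((2 : ℤ) ^ (K + 1) * (ρ + 1) : ℤ) : ℝ) := by exact_mod_cast hK2
    push_cast at this
    rw [pow_succ] at this
    linarith
  set D : ℝ := (boxAvg v a rK - boxAvg v a R) ^ 2 with hD
  have hD0 : 0 ≤ D := sq_nonneg _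
  have hnest : ((box a rK).card : ℝ) * D ≤ exc v a R := card_mul_sq_sub_le_exc v (box_mono a hrKR)
  have hexcR : exc v a R ≤ 12 * G * ((R : ℝ) + 1) ^ 2 := by
    have h := exc_le_four_mul_gradSq v a hR0
    rw [hd3] at h
    linarith
  obtain ⟨_, hcardlo, _⟩ := card_box_three hd a hrK0
  have h1 : ((rK : ℝ) + 1) ^ 3 * D ≤ 48 * G * ((rK : ℝ) + 1) ^ 2 := by
    calc ((rK : ℝ) + 1) ^ 3 * D ≤ ((box a rK).card : ℝ) * D := mul_le_mul_of_nonneg_right hcardlo hD0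
      _ ≤ 12 * G * ((R : ℝ) + 1) ^ 2 := hnest.trans hexcR
      _ ≤ 12 * G * (2 * ((rK : ℝ) + 1)) ^ 2 := by
          apply mul_le_mul_of_nonneg_left _ (by positivity)
          have hR0' : (0 : ℝ) ≤ (R : ℝ) + 1 := by
            have : (0 : ℝ) ≤ R := by exact_mod_cast hR0
            linarith
          exact pow_le_pow_left₀ hR0' hRlt 2
      _ = 48 * G * ((rK : ℝ) + 1) ^ 2 := by ring
  have h2 : ((rK : ℝ) + 1) * D ≤ 48 * G := by
    have hp : (0 : ℝ) < ((rK : ℝ) + 1) ^ 2 := by positivity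
    have : ((rK : ℝ) + 1) ^ 2 * (((rK : ℝ) + 1) * D) ≤ ((rK : ℝ) + 1) ^ 2 * (48 * G) := by nlinarith
    exact le_of_mul_le_mul_left this hp
  have hlast : D ≤ 48 * G / ((ρ : ℝ) + 1) := by
    rw [le_div_iff₀ hρ1]
    calc D * ((ρ : ℝ) + 1) ≤ D * ((rK : ℝ) + 1) := mul_le_mul_of_nonneg_left hrK1 hD0
      _ = ((rK : ℝ) + 1) * D := by ring
      _ ≤ 48 * G := h2
  -- combine
  have hsplit : (boxAvg v a ρ - boxAvg v a R) ^ 2 ≤ 2 * (boxAvg v a ρ - boxAvg v a rK) ^ 2 + 2 * D := by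
    rw [hD]; nlinarith [sq_nonneg ((boxAvg v a ρ - boxAvg v a rK) - (boxAvg v a rK - boxAvg v a R))]
  calc (boxAvg v a ρ - boxAvg v a R) ^ 2 ≤ 2 * (boxAvg v a ρ - boxAvg v a rK) ^ 2 + 2 * D := hsplit
    _ ≤ 2 * (64 * (12 * G) / ((ρ : ℝ) + 1)) + 2 * (48 * G / ((ρ : ℝ) + 1)) := by linarith [hdy, hlast]
    _ = 1632 * G / ((ρ : ℝ) + 1) := by field_simp; ring

/-- `#Q_ρ(a)·(boxAvg v a ρ − boxAvg v a R)² ≤ 13056·(ρ+1)²·gradSq v Q_R(a)` (`#Q_ρ ≤ 8(ρ+1)³`). [folklore] [cite: Giaquinta1984, Ch. III §1 Lemma 1.1 p.70] -/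
theorem card_mul_sq_boxAvg_sub_le (hd : d = 3) (v : Zd d → ℝ) (a : Zd d) {ρ R : ℤ} (hρ : 0 ≤ ρ) (hρR : ρ ≤ R) :
    ((box a ρ).card : ℝ) * (boxAvg v a ρ - boxAvg v a R) ^ 2 ≤ 13056 * ((ρ : ℝ) + 1) ^ 2 * gradSq v (box a R) := by
  have h := sq_boxAvg_sub_le_gradSq_div hd v a hρ hρR
  obtain ⟨_, _, hcardhi⟩ := card_box_three hd a hρ
  have hρ0 : (0 : ℝ) ≤ ρ := by exact_mod_cast hρ
  have hρ1 : (0 : ℝ) < (ρ : ℝ) + 1 := by linarith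
  have hG0 : 0 ≤ gradSq v (box a R) := gradSq_nonneg v _
  have hD0 : 0 ≤ (boxAvg v a ρ - boxAvg v a R) ^ 2 := sq_nonneg _
  have h' : ((ρ : ℝ) + 1) * (boxAvg v a ρ - boxAvg v a R) ^ 2 ≤ 1632 * gradSq v (box a R) := by
    rw [le_div_iff₀ hρ1] at h; linarith
  calc ((box a ρ).card : ℝ) * (boxAvg v a ρ - boxAvg v a R) ^ 2 ≤ 8 * ((ρ : ℝ) + 1) ^ 3 * (boxAvg v a ρ - boxAvg v a R) ^ 2 :=
        mul_le_mul_of_nonneg_right hcardhi hD0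
    _ = 8 * ((ρ : ℝ) + 1) ^ 2 * (((ρ : ℝ) + 1) * (boxAvg v a ρ - boxAvg v a R) ^ 2) := by ring
    _ ≤ 8 * ((ρ : ℝ) + 1) ^ 2 * (1632 * gradSq v (box a R)) := mul_le_mul_of_nonneg_left h' (by positivity)
    _ = 13056 * ((ρ : ℝ) + 1) ^ 2 * gradSq v (box a R) := by ring

/-- `Σ_{x ∈ Q_ρ(a)} (v x − boxAvg v a R)² ≤ 13068·(ρ+1)²·gradSq v Q_R(a)` (`= exc_ρ + #Q_ρ·(avg_ρ − avg_R)²`; `exc_ρ ≤ 12(ρ+1)²·gradSq`).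
[folklore] [cite: Giaquinta1984, Ch. III §1 p.70] -/
theorem sum_sq_sub_boxAvg_le (hd : d = 3) (v : Zd d → ℝ) (a : Zd d) {ρ R : ℤ} (hρ : 0 ≤ ρ) (hρR : ρ ≤ R) :
    ∑ x ∈ box a ρ, (v x - boxAvg v a R) ^ 2 ≤ 13068 * ((ρ : ℝ) + 1) ^ 2 * gradSq v (box a R) := by
  rw [sum_sq_sub_eq]
  have h1 := card_mul_sq_boxAvg_sub_le hd v a hρ hρR
  have h2 := exc_le_gradSq_of_subset v hρ (box_mono a hρR)
  have hd3 : ((d : ℕ) : ℝ) = 3 := by rw [hd]; norm_num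
  rw [hd3] at h2
  linarith

/-! ## §3 The localised-mass row (`d = 3`, real-valued) -/

/-- ★★ **THE d = 3 LOCALISED-MASS (HARDY-TYPE) ROW**: for `0 ≤ ρ ≤ R` and every `t > 0`,
`Σ_{x ∈ Q_ρ(a)} v x² ≤ (1+t)·(#Q_ρ(a)∕#Q_R(a))·Σ_{x ∈ Q_R(a)} v x² + (1+t⁻¹)·13068·(ρ+1)²·gradSq v Q_R(a)` — the mass in the small box is the VOLUME FRACTION of the mass
in the big box plus a gradient term with the SMALL radius squared (no `R`, no log: `d = 3`). (`v = (v − avg_R) + avg_R` weighted; Jensen `#Q_R·avg_R² ≤ Σ_{Q_R}v²`; §2.)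
[folklore] [cite: Giaquinta1984, Ch. III §1 pp.65–72; Balaban1984PropagatorsII, (1.9) p.226] -/
theorem sum_sq_le_localisedMass (hd : d = 3) (v : Zd d → ℝ) (a : Zd d) {ρ R : ℤ} (hρ : 0 ≤ ρ) (hρR : ρ ≤ R) {t : ℝ} (ht : 0 < t) :
    ∑ x ∈ box a ρ, v x ^ 2 ≤
      (1 + t) * (((box a ρ).card : ℝ) / ((box a R).card : ℝ)) * ∑ x ∈ box a R, v x ^ 2 +
        (1 + 1 / t) * 13068 * ((ρ : ℝ) + 1) ^ 2 * gradSq v (box a R) := by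
  set m : ℝ := boxAvg v a R with hm
  have hR0 : 0 ≤ R := hρ.trans hρR
  have hcardR : (0 : ℝ) < ((box a R).card : ℝ) := lt_of_lt_of_le one_pos (one_le_card_box a hR0)
  -- pointwise weighted split
  have hpt : ∀ x, v x ^ 2 ≤ (1 + 1 / t) * (v x - m) ^ 2 + (1 + t) * m ^ 2 := by
    intro x
    have h := add_sq_le_weighted (v x - m) m ht
    rwa [sub_add_cancel] at h
  have hsum : ∑ x ∈ box a ρ, v x ^ 2 ≤ (1 + 1 / t) * ∑ x ∈ box a ρ, (v x - m) ^ 2 + (1 + t) * (((box a ρ).card : ℝ) * m ^ 2) := by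
    calc ∑ x ∈ box a ρ, v x ^ 2 ≤ ∑ x ∈ box a ρ, ((1 + 1 / t) * (v x - m) ^ 2 + (1 + t) * m ^ 2) := Finset.sum_le_sum fun x _ => hpt x
      _ = (1 + 1 / t) * ∑ x ∈ box a ρ, (v x - m) ^ 2 + (1 + t) * (((box a ρ).card : ℝ) * m ^ 2) := by
          rw [Finset.sum_add_distrib, Finset.mul_sum, Finset.sum_const, nsmul_eq_mul]; ring
  -- Jensen on the big box
  have hJ : ((box a ρ).card : ℝ) * m ^ 2 ≤ (((box a ρ).card : ℝ) / ((box a R).card : ℝ)) * ∑ x ∈ box a R, v x ^ 2 := by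
    have hJ0 : ((box a R).card : ℝ) * m ^ 2 ≤ ∑ x ∈ box a R, v x ^ 2 := card_mul_boxAvg_sq_le v a R
    have : ((box a ρ).card : ℝ) * m ^ 2 = (((box a ρ).card : ℝ) / ((box a R).card : ℝ)) * (((box a R).card : ℝ) * m ^ 2) := by
      field_simp
    rw [this]
    exact mul_le_mul_of_nonneg_left hJ0 (by positivity)
  have hdev := sum_sq_sub_boxAvg_le hd v a hρ hρR
  have ht1 : (0 : ℝ) ≤ 1 + 1 / t := by positivity
  have ht2 : (0 : ℝ) ≤ 1 + t := by linarith
  calc ∑ x ∈ box a ρ, v x ^ 2 ≤ (1 + 1 / t) * ∑ x ∈ box a ρ, (v x - m) ^ 2 + (1 + t) * (((box a ρ).card : ℝ) * m ^ 2) := hsum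
    _ ≤ (1 + 1 / t) * (13068 * ((ρ : ℝ) + 1) ^ 2 * gradSq v (box a R)) +
          (1 + t) * ((((box a ρ).card : ℝ) / ((box a R).card : ℝ)) * ∑ x ∈ box a R, v x ^ 2) :=
        add_le_add (mul_le_mul_of_nonneg_left hdev ht1) (mul_le_mul_of_nonneg_left hJ ht2)
    _ = _ := by ring

/-- `t = 1`: `Σ_{Q_ρ} v² ≤ 2·(#Q_ρ∕#Q_R)·Σ_{Q_R} v² + 26136·(ρ+1)²·gradSq v Q_R`. [folklore] [cite: Giaquinta1984, Ch. III §1 pp.65–72] -/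
theorem sum_sq_le_localisedMass_two (hd : d = 3) (v : Zd d → ℝ) (a : Zd d) {ρ R : ℤ} (hρ : 0 ≤ ρ) (hρR : ρ ≤ R) :
    ∑ x ∈ box a ρ, v x ^ 2 ≤
      2 * (((box a ρ).card : ℝ) / ((box a R).card : ℝ)) * ∑ x ∈ box a R, v x ^ 2 + 26136 * ((ρ : ℝ) + 1) ^ 2 * gradSq v (box a R) := by
  have h := sum_sq_le_localisedMass hd v a hρ hρR one_pos
  norm_num at h
  linarith

/-! ## §4 The same row for fields valued in a finite-dimensional real inner-product space (`d = 3`) -/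

section Vector

variable {V : Type*} [NormedAddCommGroup V] [InnerProductSpace ℝ V] [FiniteDimensional ℝ V]

omit [FiniteDimensional ℝ V] in
/-- coordinates: `fdiff μ (x ↦ ⟪e, Y x⟫) y = ⟪e, Y (y + e_μ) − Y y⟫`. [folklore] -/
theorem fdiff_inner_coord (e : V) (Y : Zd d → V) (μ : Fin d) (y : Zd d) :
    fdiff μ (fun x => ⟪e, Y x⟫) y = ⟪e, Y (y + unitVec μ) - Y y⟫ := by
  rw [fdiff_apply, inner_sub_right]

/-- ★★ **THE LOCALISED-MASS ROW FOR VECTOR-VALUED FIELDS** (`d = 3`; `V` a finite-dimensional real inner-product space; SAME constants as the scalar row):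
`Σ_{x ∈ Q_ρ(a)} ‖Y x‖² ≤ (1+t)·(#Q_ρ∕#Q_R)·Σ_{x ∈ Q_R(a)} ‖Y x‖² + (1+t⁻¹)·13068·(ρ+1)²·Σ_{y ∈ Q_R(a)} Σ_μ ‖Y(y + e_μ) − Y y‖²`
(apply the scalar row to every coordinate `x ↦ ⟪b_i, Y x⟫` in an orthonormal basis and sum: every term is a sum of squares of coordinates).
[folklore] [cite: Giaquinta1984, Ch. III §1 pp.65–72] -/
theorem sum_normSq_le_localisedMass (hd : d = 3) (Y : Zd d → V) (a : Zd d) {ρ R : ℤ} (hρ : 0 ≤ ρ) (hρR : ρ ≤ R) {t : ℝ} (ht : 0 < t) :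
    ∑ x ∈ box a ρ, ‖Y x‖ ^ 2 ≤
      (1 + t) * (((box a ρ).card : ℝ) / ((box a R).card : ℝ)) * ∑ x ∈ box a R, ‖Y x‖ ^ 2 +
        (1 + 1 / t) * 13068 * ((ρ : ℝ) + 1) ^ 2 * ∑ y ∈ box a R, ∑ μ, ‖Y (y + unitVec μ) - Y y‖ ^ 2 := by
  classical
  set b := stdOrthonormalBasis ℝ V with hb
  -- every squared norm is the sum of the squared coordinates
  have hns : ∀ w : V, ‖w‖ ^ 2 = ∑ i, ⟪b i, w⟫ ^ 2 := fun w => (b.sum_sq_inner_right w).symm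
  -- the scalar row, coordinate by coordinate
  have hcoord : ∀ i, ∑ x ∈ box a ρ, ⟪b i, Y x⟫ ^ 2 ≤
      (1 + t) * (((box a ρ).card : ℝ) / ((box a R).card : ℝ)) * ∑ x ∈ box a R, ⟪b i, Y x⟫ ^ 2 +
        (1 + 1 / t) * 13068 * ((ρ : ℝ) + 1) ^ 2 * gradSq (fun x => ⟪b i, Y x⟫) (box a R) :=
    fun i => sum_sq_le_localisedMass hd (fun x => ⟪b i, Y x⟫) a hρ hρR ht
  have hgrad : ∀ i, gradSq (fun x => ⟪b i, Y x⟫) (box a R) = ∑ y ∈ box a R, ∑ μ, ⟪b i, Y (y + unitVec μ) - Y y⟫ ^ 2 := by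
    intro i
    rw [gradSq_def]
    refine Finset.sum_congr rfl fun y _ => Finset.sum_congr rfl fun μ _ => ?_
    rw [fdiff_inner_coord]
  -- rewrite every term as a sum over coordinates and add up
  have eL : ∑ x ∈ box a ρ, ‖Y x‖ ^ 2 = ∑ i, ∑ x ∈ box a ρ, ⟪b i, Y x⟫ ^ 2 := by
    rw [Finset.sum_comm]; exact Finset.sum_congr rfl fun x _ => hns (Y x)
  have eM : ∑ x ∈ box a R, ‖Y x‖ ^ 2 = ∑ i, ∑ x ∈ box a R, ⟪b i, Y x⟫ ^ 2 := by
    rw [Finset.sum_comm]; exact Finset.sum_congr rfl fun x _ => hns (Y x)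
  have eG : ∑ y ∈ box a R, ∑ μ, ‖Y (y + unitVec μ) - Y y‖ ^ 2 = ∑ i, ∑ y ∈ box a R, ∑ μ, ⟪b i, Y (y + unitVec μ) - Y y⟫ ^ 2 := by
    have e1 : ∑ y ∈ box a R, ∑ μ, ‖Y (y + unitVec μ) - Y y‖ ^ 2 = ∑ y ∈ box a R, ∑ μ, ∑ i, ⟪b i, Y (y + unitVec μ) - Y y⟫ ^ 2 :=
      Finset.sum_congr rfl fun y _ => Finset.sum_congr rfl fun μ _ => hns _
    have e2 : ∀ y ∈ box a R, ∑ μ, ∑ i, ⟪b i, Y (y + unitVec μ) - Y y⟫ ^ 2 = ∑ i, ∑ μ, ⟪b i, Y (y + unitVec μ) - Y y⟫ ^ 2 :=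
      fun y _ => Finset.sum_comm
    rw [e1, Finset.sum_congr rfl e2, Finset.sum_comm]
  rw [eL, eM, eG]
  calc ∑ i, ∑ x ∈ box a ρ, ⟪b i, Y x⟫ ^ 2
      ≤ ∑ i, ((1 + t) * (((box a ρ).card : ℝ) / ((box a R).card : ℝ)) * ∑ x ∈ box a R, ⟪b i, Y x⟫ ^ 2 +
          (1 + 1 / t) * 13068 * ((ρ : ℝ) + 1) ^ 2 * ∑ y ∈ box a R, ∑ μ, ⟪b i, Y (y + unitVec μ) - Y y⟫ ^ 2) := by
        refine Finset.sum_le_sum fun i _ => ?_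
        have h := hcoord i
        rw [hgrad i] at h
        exact h
    _ = _ := by rw [Finset.sum_add_distrib, ← Finset.mul_sum, ← Finset.mul_sum]

end Vector

end Summit.QuantumFields.YangMills.Theorems.Prop7LatticeLocalisedMass

end
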